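import Summits.BirchSwinnertonDyer.BirchSwinnertonDyer.Theorems.Rank2Observatory2DescClSplitImageNodalTwo
import Literature.NumberTheory.AdelicBaseChange.PadicTensorCompletionProofs
import Mathlib.Algebra.Algebra.Hom.Rat
import HarnessLib

/-!
# BirchSwinnertonDyer — SEL2CUBIC, towards the NODAL rows: the nodal local condition at an odd split prime
# for a `ℚ_ℓ`-POINT with per-embedding square data (the Selmer-ready form of `uvecOdd_mem_splitImgOdd`)

HONEST FRAMING: route `ShaPrimaryTransfer`, seat `bsd-line-spt-p1` (g32), `--supports` item T =
`FiniteShaComponentTransfer` (stmt-22356), UNCHANGED (conjecture-grade at corank ≥ 2). BSD in rank ≥ 2 is NOT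
proved by any of this. THEOREMS ONLY.

The census nodal lemma `TwoDescCl.SplitImage.uvecOdd_mem_splitImgOdd` (`Rank2Observatory2DescClSplitImageNodal`, M4a)
takes a RATIONAL point `(x, y)` and the GLOBAL square condition `(x − e)·∏_{j∈U} w_j ∈ K^{×2}`; that is what a class in the
image of `E(ℚ)` supplies. A `2`-SELMER class supplies less and exactly what the proof uses: at the totally split prime `ℓ`
(three embeddings `φ_i : K → ℚ_ℓ`), ONE point `(x, y) ∈ E(ℚ_ℓ)` with `y ≠ 0` and, for each `i`, the LOCAL square condition
`(x − φ_i e)·φ_i(∏_{j∈U} w_j) ∈ ℚ_ℓ^{×2}` (the local Kummer image at the three places above `ℓ`). This file states and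
proves the lemma in that form — **`uvecOdd_mem_splitImgOdd_local`** (odd `ℓ`) and **`uvecTwo_mem_splitImgTwo_local`**
(`ℓ = 2`, M4a-two) — with the same kernel checks and the same conclusion
(`uvecOdd ℓ (X_j(a_i)) U ∈ splitImgOdd ℓ (X_t(a_i))`); the proof is the landed one read over `ℚ_ℓ` (M3b
`vecOdd_mem_splitImgOdd` on the scaled point, local constancy of the class map). The rational-point lemma is recovered
by casting (`uvecOdd_mem_splitImgOdd_of_rat`, a consistency check). §2 (appended) supplies the per-embedding square
data from the form a `2`-Selmer class provides them in (g30 `…SelmerCubicKillLocal`): per-place square data at every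
`w ∣ ℓ` glue to `(1 ⊗ ζ)·ρ² = x ⊗ 1 − 1 ⊗ τ` in `ℚ_ℓ ⊗_ℚ K` (`exists_tmul_sq_of_forall_extension'`, any `ζ, τ ∈ K`), and
every ring map `φ : K → ℚ_ℓ` then reads `(x − φ τ)·φ ζ ∈ ℚ_ℓ^{×2}` (`isSquare_emb_of_tmul_sq`, via `c ⊗ k ↦ c·φ k`). What remains for the ≈330 nodal census rows
(RS3N/E2N/E3R/E3N/SN/RSN) is the host certificates' Selmer reading (`…RealCurveCertSSQ*`, `…CurveCertE3N`, …), not done here.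
[cite: Cassels1991LecturesEllipticCurves, §15]
-/

-- single-conjunct summit: `Summit.BirchSwinnertonDyer.BirchSwinnertonDyer.…` repeats the name by design
set_option linter.dupNamespace false
set_option autoImplicit false

noncomputable section

open Polynomial NumberField Literature.NumberTheory.NumberFields

namespace Summit.BirchSwinnertonDyer.BirchSwinnertonDyer.Theorems.ShaPrimaryTransferSelmerCubicNodal

open Summit.BirchSwinnertonDyer.BirchSwinnertonDyer.Rank2Observatory
open Summit.BirchSwinnertonDyer.BirchSwinnertonDyer.Rank2Observatory.TwoDescCl
open Summit.BirchSwinnertonDyer.BirchSwinnertonDyer.Rank2Observatory.TwoDescCl.SplitImage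

section Padic

variable {K : Type*} [Field K] [NumberField K] {a b c : ℤ} {θ : K} {ℓ : ℕ} [hp : Fact ℓ.Prime]

/-- **NODAL LOCAL CONDITION AT AN ODD SPLIT PRIME, LOCAL FORM.** With three embeddings `φ_i : K → ℚ_ℓ`,
`φ_i θ = z_i`, `‖z_i − a_i‖ ≤ ℓ^{−N}`, a root `e ∈ 𝓞 K` of the curve cubic with `m²e = X_t(θ)`, a family `m² w_j = X_j(θ)`
of non-zero `w_j`, a point `(x, y) ∈ E(ℚ_ℓ)` with `y ≠ 0`, and a subset `U` with `(x − φ_i e)·∏_{j∈U} φ_i(w_j)` a square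
in `ℚ_ℓ` for EACH `i`: if the kernel checks pass (`X_t(a_i)` pairwise distinct, `nodeDepth + 1 ≤ N`, every `X_j(a_i) ≠ 0` with
`v_ℓ(X_j(a_i)) < N`), then the kernel's class vector `uvecOdd ℓ (X_j(a_i)) U` lies in `splitImgOdd ℓ (X_t(a_i))`.
[cite: Cassels1991LecturesEllipticCurves, §15] -/
theorem uvecOdd_mem_splitImgOdd_local (S : SqClassMapOdd ℓ) (hℓ : ℓ ≠ 2)
    (hθ : aeval θ (MonicCubic.poly a b c) = 0)
    {z : Fin 3 → ℤ_[ℓ]} {φ : Fin 3 → (K →+* ℚ_[ℓ])} (hφ : ∀ i, φ i θ = (z i : ℚ_[ℓ]))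
    {ar : Fin 3 → ℤ} {N : ℕ} (hclose : ∀ i, ‖z i - (ar i : ℤ_[ℓ])‖ ≤ (ℓ : ℝ) ^ (-(N : ℤ)))
    {A B C : ℤ} {m : ℤ} (hm : m ≠ 0) {e : 𝓞 K} {Xt : ℤ × ℤ × ℤ}
    (he : ((m ^ 2 : ℤ) : 𝓞 K) * e = TwoDescCubic.lin hθ Xt.1 Xt.2.1 Xt.2.2)
    (hroot : e ^ 3 + (A : 𝓞 K) * e ^ 2 + (B : 𝓞 K) * e + (C : 𝓞 K) = 0)
    {ι : Type*} [DecidableEq ι] {w : ι → 𝓞 K} {X : ι → ℤ × ℤ × ℤ}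
    (hw : ∀ j, ((m ^ 2 : ℤ) : 𝓞 K) * w j = TwoDescCubic.lin hθ (X j).1 (X j).2.1 (X j).2.2)
    (hw0 : ∀ j, w j ≠ 0)
    {x y : ℚ_[ℓ]} (hxy : y ^ 2 = x ^ 3 + (A : ℚ_[ℓ]) * x ^ 2 + (B : ℚ_[ℓ]) * x + (C : ℚ_[ℓ])) (hy : y ≠ 0)
    {U : Finset ι}
    (hsq : ∀ i : Fin 3,
      IsSquare ((x - φ i (algebraMap (𝓞 K) K e)) * ∏ j ∈ U, φ i (algebraMap (𝓞 K) K (w j))))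
    (hdist : ∀ i k : Fin 3, i ≠ k → evalInt (ar i) Xt ≠ evalInt (ar k) Xt)
    (hdepth : nodeDepth ℓ (fun i => evalInt (ar i) Xt) + 1 ≤ N)
    (hprec : ∀ i j, evalInt (ar i) (X j) ≠ 0 ∧ valInt ℓ (evalInt (ar i) (X j)) < N) :
    uvecOdd ℓ (fun i j => evalInt (ar i) (X j)) U ∈ splitImgOdd ℓ (fun i => evalInt (ar i) Xt) := by
  have hmQ : (m : ℚ_[ℓ]) ≠ 0 := Int.cast_ne_zero.mpr hm
  -- the scaled roots `m² φ_i(e) = X_t(z_i)` and family values `m² φ_i(w_j) = X_j(z_i)`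
  have hQt : ∀ i, ((m ^ 2 : ℤ) : ℚ_[ℓ]) * φ i (algebraMap (𝓞 K) K e) = (quadZ Xt (z i) : ℚ_[ℓ]) :=
    fun i => mul_emb_eq_quadZ hθ (φ i) (hφ i) he
  have hQX : ∀ i j, ((m ^ 2 : ℤ) : ℚ_[ℓ]) * φ i (algebraMap (𝓞 K) K (w j)) = (quadZ (X j) (z i) : ℚ_[ℓ]) :=
    fun i j => mul_emb_eq_quadZ hθ (φ i) (hφ i) (hw j)
  have hTt : ∀ i, ∃ T : ℤ_[ℓ], quadZ Xt (z i) = (evalInt (ar i) Xt : ℤ_[ℓ]) + (ℓ : ℤ_[ℓ]) ^ N * T :=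
    fun i => exists_quadZ_eq_add (hclose i) Xt
  -- the three `φ_i(e)` are roots of `F` in `ℚ_ℓ`, pairwise distinct
  have hrootQ : ∀ i, (φ i (algebraMap (𝓞 K) K e)) ^ 3 + (A : ℚ_[ℓ]) * (φ i (algebraMap (𝓞 K) K e)) ^ 2 +
      (B : ℚ_[ℓ]) * φ i (algebraMap (𝓞 K) K e) + (C : ℚ_[ℓ]) = 0 := by
    intro i
    have h := congrArg (fun t : 𝓞 K => φ i (algebraMap (𝓞 K) K t)) hroot
    simp only [map_add, map_mul, map_pow, map_intCast, map_zero] at h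
    exact h
  have hinj : ∀ i k : Fin 3, i ≠ k → φ i (algebraMap (𝓞 K) K e) ≠ φ k (algebraMap (𝓞 K) K e) := by
    intro i k hik heq
    obtain ⟨Ti, hTi⟩ := hTt i
    obtain ⟨Tk, hTk⟩ := hTt k
    have hq : quadZ Xt (z i) = quadZ Xt (z k) := by
      apply Subtype.ext
      show (quadZ Xt (z i) : ℚ_[ℓ]) = (quadZ Xt (z k) : ℚ_[ℓ])
      rw [← hQt i, ← hQt k, heq]
    rw [hTi, hTk] at hq
    rcases (pow_dvd_iff_valInt N _).mp (pow_dvd_sub_of_eq hq) with h0 | hle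
    · exact hdist i k hik (sub_eq_zero.mp h0)
    · have h1 := valInt_sub_le_nodeDepth (ℓ := ℓ) (fun i => evalInt (ar i) Xt) i k hik
      omega
  have hF := cubic_eq_prod3 (hrootQ 0) (hrootQ 1) (hrootQ 2) (hinj 0 1 (by decide)) (hinj 0 2 (by decide))
    (hinj 1 2 (by decide))
  -- the curve equation in `ℚ_ℓ`, factored, and its scaled form
  have hc : y ^ 2 = (x - φ 0 (algebraMap (𝓞 K) K e)) * (x - φ 1 (algebraMap (𝓞 K) K e)) *
      (x - φ 2 (algebraMap (𝓞 K) K e)) := hxy.trans (hF _)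
  obtain ⟨hx0, hx1, hx2⟩ := ne_zero_of_sq hy hc
  have hxe : ∀ i : Fin 3, x - φ i (algebraMap (𝓞 K) K e) ≠ 0 := by
    intro i; fin_cases i
    exacts [hx0, hx1, hx2]
  have hy' : ((m ^ 3 : ℤ) : ℚ_[ℓ]) * y ≠ 0 := mul_ne_zero (Int.cast_ne_zero.mpr (pow_ne_zero 3 hm)) hy
  have hcurve' : (((m ^ 3 : ℤ) : ℚ_[ℓ]) * y) ^ 2 =
      (((m ^ 2 : ℤ) : ℚ_[ℓ]) * x - (quadZ Xt (z 0) : ℚ_[ℓ])) *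
      (((m ^ 2 : ℤ) : ℚ_[ℓ]) * x - (quadZ Xt (z 1) : ℚ_[ℓ])) *
      (((m ^ 2 : ℤ) : ℚ_[ℓ]) * x - (quadZ Xt (z 2) : ℚ_[ℓ])) := by
    rw [← hQt 0, ← hQt 1, ← hQt 2]
    push_cast
    linear_combination (m : ℚ_[ℓ]) ^ 6 * hc
  -- the approximations at tree precision `ℓ^(D+1)`
  have happ' : ∀ i, ∃ t : ℤ_[ℓ], quadZ Xt (z i) =
      (evalInt (ar i) Xt : ℤ_[ℓ]) + (ℓ : ℤ_[ℓ]) ^ (nodeDepth ℓ (fun i => evalInt (ar i) Xt) + 1) * t := by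
    intro i
    obtain ⟨T, hT⟩ := hTt i
    obtain ⟨d, hd⟩ := Nat.exists_eq_add_of_le hdepth
    exact ⟨(ℓ : ℤ_[ℓ]) ^ d * T, by rw [hT, hd, pow_add]; ring⟩
  -- M3b on the scaled point
  have hmem := vecOdd_mem_splitImgOdd S hℓ (e := fun i => quadZ Xt (z i)) (ē := fun i => evalInt (ar i) Xt)
    hdist happ' hy' hcurve'
  -- identify the class vector with the kernel's
  have hcls_pt : ∀ i, S.cls (((m ^ 2 : ℤ) : ℚ_[ℓ]) * x - (quadZ Xt (z i) : ℚ_[ℓ])) =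
      S.cls (x - φ i (algebraMap (𝓞 K) K e)) := by
    intro i
    have h1 : ((m ^ 2 : ℤ) : ℚ_[ℓ]) * x - (quadZ Xt (z i) : ℚ_[ℓ]) =
        (m : ℚ_[ℓ]) * (m : ℚ_[ℓ]) * (x - φ i (algebraMap (𝓞 K) K e)) := by
      rw [← hQt i]; push_cast; ring
    rw [h1, cls_mul_self_mul S hmQ (hxe i)]
  have hwK0 : ∀ i j, φ i (algebraMap (𝓞 K) K (w j)) ≠ 0 :=
    fun i j => (map_ne_zero (φ i)).mpr (RingOfIntegers.coe_ne_zero_iff.mpr (hw0 j))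
  have hcls_w : ∀ i j, S.cls (φ i (algebraMap (𝓞 K) K (w j))) = bitsInt ℓ (evalInt (ar i) (X j)) := by
    intro i j
    obtain ⟨T, hT⟩ := exists_quadZ_eq_add (hclose i) (X j)
    have h1 : S.cls (((m ^ 2 : ℤ) : ℚ_[ℓ]) * φ i (algebraMap (𝓞 K) K (w j))) = bitsInt ℓ (evalInt (ar i) (X j)) := by
      unfold bitsInt
      apply cls_eq_of_approx S hℓ T (hprec i j).1 (hprec i j).2
      rw [hQX i j, hT]
      push_cast [PadicInt.coe_natCast]
      ring
    have h2 : ((m ^ 2 : ℤ) : ℚ_[ℓ]) * φ i (algebraMap (𝓞 K) K (w j)) =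
        (m : ℚ_[ℓ]) * (m : ℚ_[ℓ]) * φ i (algebraMap (𝓞 K) K (w j)) := by
      push_cast; ring
    rw [h2, cls_mul_self_mul S hmQ (hwK0 i j)] at h1
    exact h1
  have hclsU : ∀ i, S.cls (x - φ i (algebraMap (𝓞 K) K e)) = uclsOdd ℓ (fun j => evalInt (ar i) (X j)) U := by
    intro i
    have hprod0 : ∏ j ∈ U, φ i (algebraMap (𝓞 K) K (w j)) ≠ 0 :=
      Finset.prod_ne_zero_iff.mpr fun j _ => hwK0 i j
    rw [cls_eq_of_isSquare_mul S (hxe i) hprod0 (hsq i), cls_prod S _ U (fun j _ => hwK0 i j)]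
    have hf1 : (fun j => (S.cls (φ i (algebraMap (𝓞 K) K (w j)))).1) =
        fun j => (bitsInt ℓ (evalInt (ar i) (X j))).1 := funext fun j => by rw [hcls_w i j]
    have hf2 : (fun j => (S.cls (φ i (algebraMap (𝓞 K) K (w j)))).2) =
        fun j => (bitsInt ℓ (evalInt (ar i) (X j))).2 := funext fun j => by rw [hcls_w i j]
    rw [hf1, hf2]
    rfl
  have hvec : vecOdd S (((m ^ 2 : ℤ) : ℚ_[ℓ]) * x) (fun i => quadZ Xt (z i)) =
      uvecOdd ℓ (fun i j => evalInt (ar i) (X j)) U := by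
    unfold vecOdd uvecOdd
    simp only [hcls_pt, hclsU]
  rw [← hvec]
  exact hmem

/-- **Consistency with the census lemma**: a RATIONAL point with the GLOBAL square condition
`(x − e)·∏_{j∈U} w_j ∈ K^{×2}` satisfies the local hypotheses at every embedding, so `uvecOdd_mem_splitImgOdd` is the
special case of `uvecOdd_mem_splitImgOdd_local` (same conclusion). [cite: Cassels1991LecturesEllipticCurves, §15] -/
theorem uvecOdd_mem_splitImgOdd_of_rat (S : SqClassMapOdd ℓ) (hℓ : ℓ ≠ 2)
    (hθ : aeval θ (MonicCubic.poly a b c) = 0)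
    {z : Fin 3 → ℤ_[ℓ]} {φ : Fin 3 → (K →+* ℚ_[ℓ])} (hφ : ∀ i, φ i θ = (z i : ℚ_[ℓ]))
    {ar : Fin 3 → ℤ} {N : ℕ} (hclose : ∀ i, ‖z i - (ar i : ℤ_[ℓ])‖ ≤ (ℓ : ℝ) ^ (-(N : ℤ)))
    {A B C : ℤ} {m : ℤ} (hm : m ≠ 0) {e : 𝓞 K} {Xt : ℤ × ℤ × ℤ}
    (he : ((m ^ 2 : ℤ) : 𝓞 K) * e = TwoDescCubic.lin hθ Xt.1 Xt.2.1 Xt.2.2)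
    (hroot : e ^ 3 + (A : 𝓞 K) * e ^ 2 + (B : 𝓞 K) * e + (C : 𝓞 K) = 0)
    {ι : Type*} [DecidableEq ι] {w : ι → 𝓞 K} {X : ι → ℤ × ℤ × ℤ}
    (hw : ∀ j, ((m ^ 2 : ℤ) : 𝓞 K) * w j = TwoDescCubic.lin hθ (X j).1 (X j).2.1 (X j).2.2)
    (hw0 : ∀ j, w j ≠ 0)
    {x y : ℚ} (hxy : y ^ 2 = x ^ 3 + A * x ^ 2 + B * x + C) (hy : y ≠ 0)
    {U : Finset ι}
    (hsq : IsSquare ((algebraMap ℚ K x - algebraMap (𝓞 K) K e) * ∏ j ∈ U, algebraMap (𝓞 K) K (w j)))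
    (hdist : ∀ i k : Fin 3, i ≠ k → evalInt (ar i) Xt ≠ evalInt (ar k) Xt)
    (hdepth : nodeDepth ℓ (fun i => evalInt (ar i) Xt) + 1 ≤ N)
    (hprec : ∀ i j, evalInt (ar i) (X j) ≠ 0 ∧ valInt ℓ (evalInt (ar i) (X j)) < N) :
    uvecOdd ℓ (fun i j => evalInt (ar i) (X j)) U ∈ splitImgOdd ℓ (fun i => evalInt (ar i) Xt) := by
  have hxyQ : ((y : ℚ_[ℓ])) ^ 2 = (x : ℚ_[ℓ]) ^ 3 + (A : ℚ_[ℓ]) * (x : ℚ_[ℓ]) ^ 2 + (B : ℚ_[ℓ]) * (x : ℚ_[ℓ]) +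
      (C : ℚ_[ℓ]) := by
    have h := congrArg (Rat.cast : ℚ → ℚ_[ℓ]) hxy
    push_cast at h
    exact h
  have hyQ : (y : ℚ_[ℓ]) ≠ 0 := Rat.cast_ne_zero.mpr hy
  have hxK : ∀ i, φ i (algebraMap ℚ K x) = (x : ℚ_[ℓ]) := fun i => by
    rw [eq_ratCast (algebraMap ℚ K) x, map_ratCast]
  have hsq' : ∀ i : Fin 3, IsSquare (((x : ℚ_[ℓ]) - φ i (algebraMap (𝓞 K) K e)) *
      ∏ j ∈ U, φ i (algebraMap (𝓞 K) K (w j))) := by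
    intro i
    have h := hsq.map (φ i)
    rwa [map_mul, map_sub, hxK i, map_prod] at h
  exact uvecOdd_mem_splitImgOdd_local S hℓ hθ hφ hclose hm he hroot hw hw0 hxyQ hyQ hsq' hdist hdepth hprec

/-- **NODAL LOCAL CONDITION AT A 2-ADICALLY SPLIT PRIME, LOCAL FORM** (`ℓ = 2`): as `uvecTwo_mem_splitImgTwo`
(`Rank2Observatory2DescClSplitImageNodalTwo`) but for a point `(x, y) ∈ E(ℚ_2)`, `y ≠ 0`, with the per-embedding square
conditions `(x − φ_i e)·∏_{j∈U} φ_i(w_j) ∈ ℚ_2^{×2}`; conclusion: the 9-bit class vector `uvecTwo (X_j(a_i)) U` lies in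
`splitImgTwo (X_t(a_i))`. [cite: Cassels1991LecturesEllipticCurves, §15] -/
theorem uvecTwo_mem_splitImgTwo_local (S : SqClassMapTwo)
    (hθ : aeval θ (MonicCubic.poly a b c) = 0)
    {z : Fin 3 → ℤ_[2]} {φ : Fin 3 → (K →+* ℚ_[2])} (hφ : ∀ i, φ i θ = (z i : ℚ_[2]))
    {ar : Fin 3 → ℤ} {N : ℕ} (hclose : ∀ i, ‖z i - (ar i : ℤ_[2])‖ ≤ ((2 : ℕ) : ℝ) ^ (-(N : ℤ)))
    {A B C : ℤ} {m : ℤ} (hm : m ≠ 0) {e : 𝓞 K} {Xt : ℤ × ℤ × ℤ}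
    (he : ((m ^ 2 : ℤ) : 𝓞 K) * e = TwoDescCubic.lin hθ Xt.1 Xt.2.1 Xt.2.2)
    (hroot : e ^ 3 + (A : 𝓞 K) * e ^ 2 + (B : 𝓞 K) * e + (C : 𝓞 K) = 0)
    {ι : Type*} [DecidableEq ι] {w : ι → 𝓞 K} {X : ι → ℤ × ℤ × ℤ}
    (hw : ∀ j, ((m ^ 2 : ℤ) : 𝓞 K) * w j = TwoDescCubic.lin hθ (X j).1 (X j).2.1 (X j).2.2)
    (hw0 : ∀ j, w j ≠ 0)
    {x y : ℚ_[2]} (hxy : y ^ 2 = x ^ 3 + (A : ℚ_[2]) * x ^ 2 + (B : ℚ_[2]) * x + (C : ℚ_[2])) (hy : y ≠ 0)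
    {U : Finset ι}
    (hsq : ∀ i : Fin 3,
      IsSquare ((x - φ i (algebraMap (𝓞 K) K e)) * ∏ j ∈ U, φ i (algebraMap (𝓞 K) K (w j))))
    (hdist : ∀ i k : Fin 3, i ≠ k → evalInt (ar i) Xt ≠ evalInt (ar k) Xt)
    (hdepth : nodeDepth 2 (fun i => evalInt (ar i) Xt) + 4 ≤ N)
    (hprec : ∀ i j, evalInt (ar i) (X j) ≠ 0 ∧ valInt 2 (evalInt (ar i) (X j)) + 3 ≤ N) :
    uvecTwo (fun i j => evalInt (ar i) (X j)) U ∈ splitImgTwo (fun i => evalInt (ar i) Xt) := by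
  have hmQ : (m : ℚ_[2]) ≠ 0 := Int.cast_ne_zero.mpr hm
  have hQt : ∀ i, ((m ^ 2 : ℤ) : ℚ_[2]) * φ i (algebraMap (𝓞 K) K e) = (quadZ Xt (z i) : ℚ_[2]) :=
    fun i => mul_emb_eq_quadZ hθ (φ i) (hφ i) he
  have hQX : ∀ i j, ((m ^ 2 : ℤ) : ℚ_[2]) * φ i (algebraMap (𝓞 K) K (w j)) = (quadZ (X j) (z i) : ℚ_[2]) :=
    fun i j => mul_emb_eq_quadZ hθ (φ i) (hφ i) (hw j)
  have hTt : ∀ i, ∃ T : ℤ_[2], quadZ Xt (z i) = (evalInt (ar i) Xt : ℤ_[2]) + ((2 : ℕ) : ℤ_[2]) ^ N * T :=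
    fun i => exists_quadZ_eq_add (hclose i) Xt
  have hrootQ : ∀ i, (φ i (algebraMap (𝓞 K) K e)) ^ 3 + (A : ℚ_[2]) * (φ i (algebraMap (𝓞 K) K e)) ^ 2 +
      (B : ℚ_[2]) * φ i (algebraMap (𝓞 K) K e) + (C : ℚ_[2]) = 0 := by
    intro i
    have h := congrArg (fun t : 𝓞 K => φ i (algebraMap (𝓞 K) K t)) hroot
    simp only [map_add, map_mul, map_pow, map_intCast, map_zero] at h
    exact h
  have hinj : ∀ i k : Fin 3, i ≠ k → φ i (algebraMap (𝓞 K) K e) ≠ φ k (algebraMap (𝓞 K) K e) := by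
    intro i k hik heq
    obtain ⟨Ti, hTi⟩ := hTt i
    obtain ⟨Tk, hTk⟩ := hTt k
    have hq : quadZ Xt (z i) = quadZ Xt (z k) := by
      apply Subtype.ext
      show (quadZ Xt (z i) : ℚ_[2]) = (quadZ Xt (z k) : ℚ_[2])
      rw [← hQt i, ← hQt k, heq]
    rw [hTi, hTk] at hq
    rcases (pow_dvd_iff_valInt N _).mp (pow_dvd_sub_of_eq hq) with h0 | hle
    · exact hdist i k hik (sub_eq_zero.mp h0)
    · have h1 := valInt_sub_le_nodeDepth (ℓ := 2) (fun i => evalInt (ar i) Xt) i k hik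
      omega
  have hF := cubic_eq_prod3 (hrootQ 0) (hrootQ 1) (hrootQ 2) (hinj 0 1 (by decide)) (hinj 0 2 (by decide))
    (hinj 1 2 (by decide))
  have hc : y ^ 2 = (x - φ 0 (algebraMap (𝓞 K) K e)) * (x - φ 1 (algebraMap (𝓞 K) K e)) *
      (x - φ 2 (algebraMap (𝓞 K) K e)) := hxy.trans (hF _)
  obtain ⟨hx0, hx1, hx2⟩ := ne_zero_of_sq hy hc
  have hxe : ∀ i : Fin 3, x - φ i (algebraMap (𝓞 K) K e) ≠ 0 := by
    intro i; fin_cases i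
    exacts [hx0, hx1, hx2]
  have hy' : ((m ^ 3 : ℤ) : ℚ_[2]) * y ≠ 0 := mul_ne_zero (Int.cast_ne_zero.mpr (pow_ne_zero 3 hm)) hy
  have hcurve' : (((m ^ 3 : ℤ) : ℚ_[2]) * y) ^ 2 =
      (((m ^ 2 : ℤ) : ℚ_[2]) * x - (quadZ Xt (z 0) : ℚ_[2])) *
      (((m ^ 2 : ℤ) : ℚ_[2]) * x - (quadZ Xt (z 1) : ℚ_[2])) *
      (((m ^ 2 : ℤ) : ℚ_[2]) * x - (quadZ Xt (z 2) : ℚ_[2])) := by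
    rw [← hQt 0, ← hQt 1, ← hQt 2]
    push_cast
    linear_combination (m : ℚ_[2]) ^ 6 * hc
  have happ' : ∀ i, ∃ t : ℤ_[2], quadZ Xt (z i) =
      (evalInt (ar i) Xt : ℤ_[2]) + (2 : ℤ_[2]) ^ (nodeDepth 2 (fun i => evalInt (ar i) Xt) + 4) * t := by
    intro i
    obtain ⟨T, hT⟩ := hTt i
    obtain ⟨d, hd⟩ := Nat.exists_eq_add_of_le hdepth
    refine ⟨(2 : ℤ_[2]) ^ d * T, ?_⟩
    rw [hT, hd, pow_add, Nat.cast_ofNat]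
    ring
  have hmem := vecTwo_mem_splitImgTwo S (e := fun i => quadZ Xt (z i)) (ē := fun i => evalInt (ar i) Xt)
    hdist happ' hy' hcurve'
  have hcls_pt : ∀ i, S.cls (((m ^ 2 : ℤ) : ℚ_[2]) * x - (quadZ Xt (z i) : ℚ_[2])) =
      S.cls (x - φ i (algebraMap (𝓞 K) K e)) := by
    intro i
    have h1 : ((m ^ 2 : ℤ) : ℚ_[2]) * x - (quadZ Xt (z i) : ℚ_[2]) =
        (m : ℚ_[2]) * (m : ℚ_[2]) * (x - φ i (algebraMap (𝓞 K) K e)) := by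
      rw [← hQt i]; push_cast; ring
    rw [h1, cls_mul_self_mul_two S hmQ (hxe i)]
  have hwK0 : ∀ i j, φ i (algebraMap (𝓞 K) K (w j)) ≠ 0 :=
    fun i j => (map_ne_zero (φ i)).mpr (RingOfIntegers.coe_ne_zero_iff.mpr (hw0 j))
  have hcls_w : ∀ i j, S.cls (φ i (algebraMap (𝓞 K) K (w j))) = bitsIntTwo (evalInt (ar i) (X j)) := by
    intro i j
    obtain ⟨T, hT⟩ := exists_quadZ_eq_add (hclose i) (X j)
    have h1 : S.cls (((m ^ 2 : ℤ) : ℚ_[2]) * φ i (algebraMap (𝓞 K) K (w j))) = bitsIntTwo (evalInt (ar i) (X j)) := by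
      unfold bitsIntTwo
      apply cls_eq_of_approx_two S T (hprec i j).1 (hprec i j).2
      rw [hQX i j, hT]
      push_cast [PadicInt.coe_natCast, Nat.cast_ofNat, coe_two]
      ring
    have h2 : ((m ^ 2 : ℤ) : ℚ_[2]) * φ i (algebraMap (𝓞 K) K (w j)) =
        (m : ℚ_[2]) * (m : ℚ_[2]) * φ i (algebraMap (𝓞 K) K (w j)) := by
      push_cast; ring
    rw [h2, cls_mul_self_mul_two S hmQ (hwK0 i j)] at h1
    exact h1
  have hclsU : ∀ i, S.cls (x - φ i (algebraMap (𝓞 K) K e)) = uclsTwo (fun j => evalInt (ar i) (X j)) U := by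
    intro i
    have hprod0 : ∏ j ∈ U, φ i (algebraMap (𝓞 K) K (w j)) ≠ 0 :=
      Finset.prod_ne_zero_iff.mpr fun j _ => hwK0 i j
    rw [cls_eq_of_isSquare_mul_two S (hxe i) hprod0 (hsq i), cls_prod_two S _ U (fun j _ => hwK0 i j)]
    have hf1 : (fun j => (S.cls (φ i (algebraMap (𝓞 K) K (w j)))).1) =
        fun j => (bitsIntTwo (evalInt (ar i) (X j))).1 := funext fun j => by rw [hcls_w i j]
    have hf2 : (fun j => (S.cls (φ i (algebraMap (𝓞 K) K (w j)))).2.1) =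
        fun j => (bitsIntTwo (evalInt (ar i) (X j))).2.1 := funext fun j => by rw [hcls_w i j]
    have hf3 : (fun j => (S.cls (φ i (algebraMap (𝓞 K) K (w j)))).2.2) =
        fun j => (bitsIntTwo (evalInt (ar i) (X j))).2.2 := funext fun j => by rw [hcls_w i j]
    rw [hf1, hf2, hf3]
    rfl
  have hvec : vecTwo S (((m ^ 2 : ℤ) : ℚ_[2]) * x) (fun i => quadZ Xt (z i)) =
      uvecTwo (fun i j => evalInt (ar i) (X j)) U := by
    unfold vecTwo uvecTwo
    simp only [hcls_pt, hclsU]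
  rw [← hvec]
  exact hmem

end Padic

/-! ## §2 (appended) From the semi-local square datum of a Selmer class to the per-embedding square data -/

section Tensor

open scoped TensorProduct

variable {K : Type} [Field K] [NumberField K] {ℓ : ℕ} [Fact ℓ.Prime]

/-- **Reading a square in `ℚ_ℓ ⊗_ℚ K` along an embedding.** If `(1 ⊗ ζ)·ρ² = x ⊗ 1 − 1 ⊗ τ` in `ℚ_ℓ ⊗_ℚ K`, then for
every ring map `φ : K → ℚ_ℓ` the element `(x − φ τ)·φ ζ` is a square in `ℚ_ℓ` (apply the algebra map `c ⊗ k ↦ c·φ(k)`,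
`Algebra.TensorProduct.lift`). [cite: CasselsFrohlichANT1967, Ch. II §10 Theorem (10.2)] -/
theorem isSquare_emb_of_tmul_sq {x : ℚ_[ℓ]} {ζ τ : K} {ρ : ℚ_[ℓ] ⊗[ℚ] K}
    (h : ((1 : ℚ_[ℓ]) ⊗ₜ[ℚ] ζ) * ρ ^ 2 = x ⊗ₜ[ℚ] (1 : K) - (1 : ℚ_[ℓ]) ⊗ₜ[ℚ] τ) (φ : K →+* ℚ_[ℓ]) :
    IsSquare ((x - φ τ) * φ ζ) := by
  let Λ : ℚ_[ℓ] ⊗[ℚ] K →ₐ[ℚ] ℚ_[ℓ] :=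
    Algebra.TensorProduct.lift (AlgHom.id ℚ ℚ_[ℓ]) φ.toRatAlgHom (fun _ _ => Commute.all _ _)
  have hΛ : ∀ (c : ℚ_[ℓ]) (k : K), Λ (c ⊗ₜ[ℚ] k) = c * φ k := fun c k => by
    simp only [Λ, Algebra.TensorProduct.lift_tmul, AlgHom.id_apply, RingHom.toRatAlgHom_apply]
  have h' := congrArg Λ h
  rw [map_mul, map_pow, map_sub, hΛ, hΛ, hΛ, one_mul, one_mul, map_one, mul_one] at h'
  exact ⟨φ ζ * Λ ρ, by linear_combination (-(φ ζ)) * h'⟩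

/-- **Per-place square data glue to the semi-local algebra** (g30's `exists_tmul_sq_of_forall_extension` for arbitrary
`ζ, τ ∈ K`, with the `p`-adic coordinate made explicit): if at EVERY place `w ∣ ℓ` of `K` the equation `ζ·ρ_w² = x − τ`
is solvable in `K_w` for one `x ∈ ℚ_{v_ℓ}`, then `(1 ⊗ ζ)·ρ² = e⁻¹(x) ⊗ 1 − 1 ⊗ τ` is solvable in `ℚ_ℓ ⊗_ℚ K`,
`e = Padic.adicCompletionEquiv` (via the tree's `ℚ_ℓ ⊗_ℚ K ≅ ∏_{w ∣ ℓ} K_w`, `exists_padicTensorAlgEquiv`).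
[cite: CasselsFrohlichANT1967, Ch. II §10 Theorem (10.2)] -/
theorem exists_tmul_sq_of_forall_extension' (ζ τ : K)
    (xv : ((Rat.HeightOneSpectrum.primesEquiv (R := 𝓞 ℚ)).symm ⟨ℓ, Fact.out⟩).adicCompletion ℚ)
    (hw : ∀ w : ((Rat.HeightOneSpectrum.primesEquiv (R := 𝓞 ℚ)).symm ⟨ℓ, Fact.out⟩).Extension (𝓞 K),
      ∃ ρw : w.1.adicCompletion K,
        algebraMap K (w.1.adicCompletion K) ζ * ρw ^ 2 =
          algebraMap (((Rat.HeightOneSpectrum.primesEquiv (R := 𝓞 ℚ)).symm ⟨ℓ, Fact.out⟩).adicCompletion ℚ)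
              (w.1.adicCompletion K) xv -
            algebraMap K (w.1.adicCompletion K) τ) :
    ∃ ρ : ℚ_[ℓ] ⊗[ℚ] K,
      ((1 : ℚ_[ℓ]) ⊗ₜ[ℚ] ζ) * ρ ^ 2 =
        ((Padic.adicCompletionEquiv (𝓞 ℚ) ⟨ℓ, Fact.out⟩).symm xv) ⊗ₜ[ℚ] (1 : K) - (1 : ℚ_[ℓ]) ⊗ₜ[ℚ] τ := by
  obtain ⟨Ψ, hΨ⟩ := Literature.NumberTheory.AdelicBaseChange.exists_padicTensorAlgEquiv K ℓ
  set e := Padic.adicCompletionEquiv (𝓞 ℚ) ⟨ℓ, Fact.out⟩ with he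
  choose ρw hρw using hw
  refine ⟨Ψ.symm (fun w => ρw w), Ψ.injective ?_⟩
  funext w
  rw [map_mul, map_pow, AlgEquiv.apply_symm_apply, map_sub, Pi.mul_apply, Pi.pow_apply, Pi.sub_apply,
    hΨ, hΨ, hΨ, map_one, map_one, mul_one, map_one, one_mul, mul_one, hρw w]
  congr 2
  exact (e.apply_symm_apply xv).symm

/-- **The per-embedding square data of the nodal lemma from per-place square data.** Composite of the two: if
`ζ·ρ_w² = x − τ` is solvable in every `K_w`, `w ∣ ℓ`, then for every ring map `φ : K → ℚ_ℓ`,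
`(e⁻¹(x) − φ τ)·φ ζ ∈ ℚ_ℓ^{×2}` — the hypothesis `hsq` of `uvecOdd_mem_splitImgOdd_local` (with `ζ = ∏_{j∈U} w_j`,
`τ` the `2`-division root) for each of the three Hensel embeddings. [cite: CasselsFrohlichANT1967, Ch. II §10 Theorem (10.2)] -/
theorem isSquare_emb_of_forall_extension (ζ τ : K)
    (xv : ((Rat.HeightOneSpectrum.primesEquiv (R := 𝓞 ℚ)).symm ⟨ℓ, Fact.out⟩).adicCompletion ℚ)
    (hw : ∀ w : ((Rat.HeightOneSpectrum.primesEquiv (R := 𝓞 ℚ)).symm ⟨ℓ, Fact.out⟩).Extension (𝓞 K),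
      ∃ ρw : w.1.adicCompletion K,
        algebraMap K (w.1.adicCompletion K) ζ * ρw ^ 2 =
          algebraMap (((Rat.HeightOneSpectrum.primesEquiv (R := 𝓞 ℚ)).symm ⟨ℓ, Fact.out⟩).adicCompletion ℚ)
              (w.1.adicCompletion K) xv -
            algebraMap K (w.1.adicCompletion K) τ)
    (φ : K →+* ℚ_[ℓ]) :
    IsSquare (((Padic.adicCompletionEquiv (𝓞 ℚ) ⟨ℓ, Fact.out⟩).symm xv - φ τ) * φ ζ) := by
  obtain ⟨ρ, hρ⟩ := exists_tmul_sq_of_forall_extension' ζ τ xv hw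
  exact isSquare_emb_of_tmul_sq hρ φ

end Tensor

end Summit.BirchSwinnertonDyer.BirchSwinnertonDyer.Theorems.ShaPrimaryTransferSelmerCubicNodal

end
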